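import Literature.AlgebraicGeometry.ModuliOfAbelianVarieties.SiegelShimuraSetPrincipalDissection
import HarnessLib

/-!
# `K_δ(1) = Sp_δ(ℤ) · {diag(1, u·1)} · K_δ(N)`: the level-one factorisation behind the principal
# representatives (Milne, *Introduction to Shimura varieties*, Lemma 5.13 / Thm. 5.17; Deligne 1971, 4.16)

Topic `AlgebraicGeometry/ModuliOfAbelianVarieties`; namespace `Literature.AlgebraicGeometry.ModuliOfAbelianVarieties`.
KERNEL ONLY: theorems; no definition, no named fact, no instance, no `sorry`.  Cell `hodgecm-mathlib`, U-DAG brick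
B4 (c) (B-p03 CENSUS-B4 §2 (c); B-plan1 R50; director s109): the GROUP-THEORETIC transport step of the existence half
of the complex uniformisation — the symplectic frame `k₀ ∈ K_δ(1) = GSp_δ(ẑ)` in which a liftable level structure reads
through a level-one marking is moved to a PRINCIPAL representative `r_c = diag(1_g, u·1_g)` by a rational INTEGRAL
symplectic matrix on the left (which moves `Z₀ ↦ γ • Z₀` on `𝔥_g`) and an element of `K_δ(N)` on the right (invisible
at level `N`):

  `k₀ = γ · r · k`,  `γ ∈ Sp_δ(ℤ) = GSp_δ(ℚ) ∩ K_δ(1) ∩ {ν = 1}`,  `r = diag(1_g, u·1_g) ∈ K_δ(1)`,  `u = ν(k₀) ∈ ẑ^×`,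
  `u ≡ c (mod N)`,  `k ∈ K_δ(N)`.

All inputs are ★: the multiplier of an element of `K_δ(1)` is a `ẑ`-unit (★ R60-4
`sub_one_mem_levelIdeal_of_isMultiplier_of_isPolarizationType` at level `1` + ★ R60-12's bridge
`forall_valued_eq_one_iff_mem_integralAdeles`), the section `u ↦ diag(1_g, u·1_g)` (★ R60-4
`exists_mem_principalLevelSubgroup_isMultiplier`), strong approximation for `Sp_δ` in its sharp two-point form
(★ R60-27 `exists_symplectic_rational_mul_mul_of_isMultiplier`), residues of `ẑ`-units (★ R60-12
`exists_int_sub_intCast_mem_levelIdeal`, `isCoprime_of_forall_valued_eq_one_of_sub_intCast_mem_levelIdeal`), and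
`ℚ ∩ ẑ = ℤ` for matrices (★ R60-11 `exists_map_intCast_eq_of_isCongOne`).

* §1 `forall_valued_eq_one_of_isMultiplier_of_mem_one` — multipliers on `K_δ(1)` are `ẑ`-units;
* §2 `exists_units_zmod_sub_val_mem_levelIdeal` (+ uniqueness `units_zmod_eq_of_sub_val_mem_levelIdeal`) — the residue
  `c ∈ (ℤ/N)^×` of a `ẑ`-unit;
* §3 **`exists_rational_mul_principalRep_mul_level_of_mem_one`** — the factorisation `k₀ = γ r k` with ALL the (U3)
  clauses on `(c, u, r)` (the exact hypothesis block of ★ `siegelModuli_complexUniformisation` / ★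
  `SiegelShimuraSet.exists_principalRep`), `γ ∈ Sp_δ(ℚ)` adelically in `K_δ(1)`, `ν(k₀) = u`, `k ∈ K_δ(N)`;
* §4 `exists_symplecticLatticeGroup_map_eq_of_mem_one` — a rational symplectic matrix adelically in `K_δ(1)` IS an
  integral symplectic matrix `M ∈ Sp_δ(ℤ)` (the level-`1` companion of ★ R60-11
  `exists_siegelLevelGroup_map_eq_of_mem_principalLevelSubgroup`, which needs `N ≥ 3` only to exclude `ν = -1`), and
  the packaged head `exists_symplecticLatticeGroup_mul_principalRep_mul_level_of_mem_one`.

## References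
* [Milne2005ShimuraVarieties] J. S. Milne, *Introduction to Shimura varieties* (2005), §5 (5.2), Lemma 5.12, Lemma 5.13
  p. 57 (proof: «`a = qgk`, `q ∈ G(ℚ)₊`, `g ∈ 𝒞`, `k ∈ K`»), Thm. 5.17 p. 59; §6 p. 70.
* [Deligne1971TravauxShimura] P. Deligne, *Travaux de Shimura* (1971), Exemple 4.16 p. 150, 1.8 p. 129.
* [PlatonovRapinchuk1994] V. Platonov, A. Rapinchuk, *Algebraic groups and number theory* (1994), §7.4 Thm. 7.12
  (strong approximation), §8.1 (class numbers).
-/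

set_option autoImplicit false

noncomputable section

open Matrix NumberField IsDedekindDomain

namespace Literature.AlgebraicGeometry.ModuliOfAbelianVarieties

open Literature.NumberTheory.Adeles

variable {g : ℕ} (δ : Fin g → ℕ)

/-! ### §1. Multipliers on `K_δ(1)` are `ẑ`-units -/

/-- **A multiplier of an element of `K_δ(1) = GSp_δ(ẑ)` is a `ẑ`-unit** (`|ν_v|_v = 1` at every place): by ★ R60-4
`ν - 1, ν⁻¹ - 1 ∈ 1·𝓞̂`, so `ν, ν⁻¹ ∈ 𝓞̂`, which is the valuation statement by ★ R60-12's bridge.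
[cite: Deligne1971TravauxShimura, Exemple 4.16 p. 150] [cite: Milne2005ShimuraVarieties, §6 p. 70] -/
theorem forall_valued_eq_one_of_isMultiplier_of_mem_one (hδ : IsPolarizationType δ) (hg : 0 < g)
    {k₀ : gspFinAdelic δ} (hk₀ : k₀ ∈ principalLevelSubgroup δ 1) {ν : finAdeleQˣ}
    (hν : IsMultiplier (typeFormOver δ finAdeleQ) (k₀ : GL (Fin g ⊕ Fin g) finAdeleQ) ν) :
    ∀ v, Valued.v ((ν : finAdeleQ) v) = 1 := by
  obtain ⟨h1, h2⟩ := sub_one_mem_levelIdeal_of_isMultiplier_of_isPolarizationType δ hδ hg hk₀ hν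
  refine (forall_valued_eq_one_iff_mem_integralAdeles ν).2 ⟨?_, ?_⟩
  · have h := add_mem (mem_integralAdeles_of_mem_levelIdeal h1)
      (one_mem (FiniteAdeleRing.integralAdeles (𝓞 ℚ) ℚ))
    rwa [sub_add_cancel] at h
  · have h := add_mem (mem_integralAdeles_of_mem_levelIdeal h2)
      (one_mem (FiniteAdeleRing.integralAdeles (𝓞 ℚ) ℚ))
    rwa [sub_add_cancel] at h

/-! ### §2. The residue class of a `ẑ`-unit in `(ℤ/N)^×` -/

/-- **The residue of a `ẑ`-unit**: for `N ≠ 0` and an idèle `u` with `|u_v|_v = 1` everywhere there is a class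
`c ∈ (ℤ/N)^×` with `u ≡ c (mod N·ẑ)` in the (U3) spelling `u - c.val ∈ N·𝓞̂` (★ R60-12: `ẑ = ℤ + N·ẑ` and the residue
of a unit is prime to `N`). [cite: Milne2005ShimuraVarieties, §5 (5.2) and Lemma 5.13 p. 57] -/
theorem exists_units_zmod_sub_val_mem_levelIdeal {N : ℕ} (hN : N ≠ 0) {u : finAdeleQˣ}
    (hu : ∀ v, Valued.v ((u : finAdeleQ) v) = 1) :
    ∃ c : (ZMod N)ˣ, (u : finAdeleQ) - ((c : ZMod N).val : ℕ) ∈ levelIdeal N := by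
  haveI : NeZero N := ⟨hN⟩
  obtain ⟨a₀, ha₀⟩ := exists_int_sub_intCast_mem_levelIdeal hN (mem_integralAdeles_of_forall_valued_eq_one hu)
  have hcop := isCoprime_of_forall_valued_eq_one_of_sub_intCast_mem_levelIdeal hN hu ha₀
  have hunit : IsUnit (a₀ : ZMod N) := (ZMod.coe_int_isUnit_iff_isCoprime a₀ N).2 hcop.symm
  refine ⟨hunit.unit, ?_⟩
  have hcval : (hunit.unit : ZMod N) = (a₀ : ZMod N) := hunit.unit_spec
  have hdvd : (N : ℤ) ∣ (((hunit.unit : ZMod N).val : ℕ) : ℤ) - a₀ := by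
    rw [← ZMod.intCast_eq_intCast_iff_dvd_sub, Int.cast_natCast, ZMod.natCast_zmod_val, hcval]
  have hmem : ((((hunit.unit : ZMod N).val : ℕ) : ℤ) : finAdeleQ) - (a₀ : finAdeleQ) ∈ levelIdeal N := by
    rw [← Int.cast_sub]
    exact (Literature.NumberTheory.Adeles.intCast_mem_levelIdeal_iff hN _).2 hdvd
  have h := sub_mem ha₀ hmem
  rwa [sub_sub_sub_cancel_right, Int.cast_natCast] at h

/-- The residue class of a finite adele in `(ℤ/N)^×` is unique (★ R60-12 `int_dvd_sub_of_sub_intCast_mem_levelIdeal`).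
[cite: Milne2005ShimuraVarieties, §5 Lemma 5.13 p. 57] -/
theorem units_zmod_eq_of_sub_val_mem_levelIdeal {N : ℕ} (hN : N ≠ 0) {u : finAdeleQ} {c c' : (ZMod N)ˣ}
    (hc : u - ((c : ZMod N).val : ℕ) ∈ levelIdeal N) (hc' : u - ((c' : ZMod N).val : ℕ) ∈ levelIdeal N) : c = c' := by
  haveI : NeZero N := ⟨hN⟩
  have h1 : u - ((((c : ZMod N).val : ℕ) : ℤ) : finAdeleQ) ∈ levelIdeal N := by rwa [Int.cast_natCast]
  have h2 : u - ((((c' : ZMod N).val : ℕ) : ℤ) : finAdeleQ) ∈ levelIdeal N := by rwa [Int.cast_natCast]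
  have hdvd := int_dvd_sub_of_sub_intCast_mem_levelIdeal hN h1 h2
  have hzmod : ((((c : ZMod N).val : ℕ) : ℤ) : ZMod N) = ((((c' : ZMod N).val : ℕ) : ℤ) : ZMod N) :=
    (ZMod.intCast_eq_intCast_iff_dvd_sub _ _ _).2 hdvd
  rw [Int.cast_natCast, Int.cast_natCast, ZMod.natCast_zmod_val, ZMod.natCast_zmod_val] at hzmod
  exact Units.ext hzmod

/-! ### §3. The factorisation `k₀ = γ · r_c · k` -/

/-- **`K_δ(1) = Sp_δ(ℚ)_{int} · diag(1, ẑ^×) · K_δ(N)`** — the level-one factorisation ([Milne ISV] Lemma 5.13, proof: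
«`a = qgk` for some `q ∈ G(ℚ)₊, g ∈ 𝒞, k ∈ K`», for `GSp_δ` with `a` integral).  For a polarisation type `δ`, `0 < g`,
`N ≠ 0` and `k₀ ∈ K_δ(1)`, there are `γ ∈ Sp_δ(ℚ)` lying adelically in `K_δ(1)`, a class `c ∈ (ℤ/N)^×`, a `ẑ`-unit `u`
with residue `c`, the principal representative `r = diag(1_g, u·1_g) ∈ K_δ(1)` of multiplier `u` (the four clauses of
★ `SiegelShimuraSet.exists_principalRep` / the (U3) hypothesis block of ★ `siegelModuli_complexUniformisation`), and
`k ∈ K_δ(N)` with `k₀ = γ · r · k`; moreover `u` is a multiplier of `k₀`.  Proof: `u := ν(k₀)` is a `ẑ`-unit (§1),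
`r := diag(1, u·1)` (★ R60-4), strong approximation in the sharp two-point form for the common multiplier `u`
(★ R60-27 `exists_symplectic_rational_mul_mul_of_isMultiplier`), and `γ = k₀ k⁻¹ r⁻¹ ∈ K_δ(1)`.
[cite: Milne2005ShimuraVarieties, §5 Lemma 5.13 p. 57 and Thm. 5.17 p. 59] [cite: Deligne1971TravauxShimura, Exemple 4.16 p. 150]
[cite: PlatonovRapinchuk1994, §7.4 Thm. 7.12] -/
theorem exists_rational_mul_principalRep_mul_level_of_mem_one (hδ : IsPolarizationType δ) (hg : 0 < g) {N : ℕ}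
    (hN : N ≠ 0) (k₀ : gspFinAdelic δ) (hk₀ : k₀ ∈ principalLevelSubgroup δ 1) :
    ∃ (γ : gspRational δ) (c : (ZMod N)ˣ) (u : finAdeleQˣ) (r k : gspFinAdelic δ),
      (γ : GL (Fin g ⊕ Fin g) ℚ) ∈ symplecticGroupOfForm (typeFormOver δ ℚ) ∧
      gspRationalToFinAdelic δ γ ∈ principalLevelSubgroup δ 1 ∧
      (∀ v, Valued.v ((u : finAdeleQ) v) = 1) ∧
      (u : finAdeleQ) - ((c : ZMod N).val : ℕ) ∈ levelIdeal N ∧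
      r ∈ principalLevelSubgroup δ 1 ∧
      IsMultiplier (typeFormOver δ finAdeleQ) (r : GL (Fin g ⊕ Fin g) finAdeleQ) u ∧
      ((r : GL (Fin g ⊕ Fin g) finAdeleQ) : Matrix (Fin g ⊕ Fin g) (Fin g ⊕ Fin g) finAdeleQ) =
        Matrix.fromBlocks 1 0 0 ((u : finAdeleQ) • (1 : Matrix (Fin g) (Fin g) finAdeleQ)) ∧
      IsMultiplier (typeFormOver δ finAdeleQ) (k₀ : GL (Fin g ⊕ Fin g) finAdeleQ) u ∧
      k ∈ principalLevelSubgroup δ N ∧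
      k₀ = gspRationalToFinAdelic δ γ * r * k := by
  -- the multiplier `u := ν(k₀)`, a `ẑ`-unit
  obtain ⟨u, hu0⟩ := mem_similitudeGroupOfForm_iff.1 k₀.2
  have hν : IsMultiplier (typeFormOver δ finAdeleQ) (k₀ : GL (Fin g ⊕ Fin g) finAdeleQ) u := hu0
  have hu : ∀ v, Valued.v ((u : finAdeleQ) v) = 1 :=
    forall_valued_eq_one_of_isMultiplier_of_mem_one δ hδ hg hk₀ hν
  obtain ⟨h1, h2⟩ := sub_one_mem_levelIdeal_one_of_forall_valued_eq_one hu
  -- the principal representative `r = diag(1, u·1) ∈ K_δ(1)` of multiplier `u`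
  obtain ⟨r, hr, hru, hrmat⟩ := exists_mem_principalLevelSubgroup_isMultiplier δ u h1 h2
  -- strong approximation, sharp two-point form: `k₀ = γ r k`
  obtain ⟨γ, hγ, k, hk, heq⟩ := exists_symplectic_rational_mul_mul_of_isMultiplier hδ.1 hN hru hν
  -- the residue class of `u`
  obtain ⟨c, hc⟩ := exists_units_zmod_sub_val_mem_levelIdeal hN hu
  refine ⟨γ, c, u, r, k, hγ, ?_, hu, hc, hr, hru, hrmat, hν, hk, heq⟩
  -- `γ = k₀ k⁻¹ r⁻¹` is adelically integral
  have hγeq : gspRationalToFinAdelic δ γ = k₀ * k⁻¹ * r⁻¹ := by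
    rw [heq]; group
  rw [hγeq]
  exact mul_mem (mul_mem hk₀ (inv_mem (principalLevelSubgroup_anti δ (one_dvd N) hk))) (inv_mem hr)

/-! ### §4. The rational factor is an integral symplectic matrix -/

/-- **`Sp_δ(ℚ) ∩ K_δ(1) = Sp_δ(ℤ)`** (level-`1` companion of ★ R60-11
`exists_siegelLevelGroup_map_eq_of_mem_principalLevelSubgroup`, which assumes `N ≥ 3` only to rule out multiplier `-1`):
a rational SYMPLECTIC matrix lying adelically in `K_δ(1)` is the rational point of a (unique, ★
`generalLinearGroup_map_intCast_injective`) `M ∈ Sp_δ(ℤ)` — entries of `γ, γ⁻¹` lie in `ℚ ∩ ẑ = ℤ` (★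
`exists_map_intCast_eq_of_isCongOne`) and `Mᵀ E_δ M = E_δ` transfers from `ℚ` by injectivity of `ℤ → ℚ`.
[cite: Deligne1971TravauxShimura, Exemple 4.16 p. 150 («Γ = K(N) ∩ G(ℚ)»)] [cite: Milne2005ShimuraVarieties, Lemma 5.13 p. 57 (footnote 40)] -/
theorem exists_symplecticLatticeGroup_map_eq_of_mem_one (γ : gspRational δ)
    (hγ : (γ : GL (Fin g ⊕ Fin g) ℚ) ∈ symplecticGroupOfForm (typeFormOver δ ℚ))
    (h : gspRationalToFinAdelic δ γ ∈ principalLevelSubgroup δ 1) :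
    ∃ M : GL (Fin g ⊕ Fin g) ℤ, M ∈ symplecticLatticeGroup δ ∧
      Matrix.GeneralLinearGroup.map (Int.castRingHom ℚ) M = (γ : GL (Fin g ⊕ Fin g) ℚ) := by
  obtain ⟨h1, h2⟩ := (mem_principalLevelSubgroup_iff δ).1 h
  rw [coe_gspRationalToFinAdelic] at h1
  change IsCongOne 1 (((Matrix.GeneralLinearGroup.map (algebraMap ℚ finAdeleQ) (γ : GL (Fin g ⊕ Fin g) ℚ))⁻¹ :
    GL (Fin g ⊕ Fin g) finAdeleQ) : Matrix (Fin g ⊕ Fin g) (Fin g ⊕ Fin g) finAdeleQ) at h2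
  obtain ⟨M, hM⟩ := exists_map_intCast_eq_of_isCongOne (γ : GL (Fin g ⊕ Fin g) ℚ) h1 h2
  refine ⟨M, ?_, hM⟩
  have hMq : (M : Matrix (Fin g ⊕ Fin g) (Fin g ⊕ Fin g) ℤ).map (Int.castRingHom ℚ) =
      ((γ : GL (Fin g ⊕ Fin g) ℚ) : Matrix (Fin g ⊕ Fin g) (Fin g ⊕ Fin g) ℚ) :=
    congrArg (fun u : GL (Fin g ⊕ Fin g) ℚ => (u : Matrix (Fin g ⊕ Fin g) (Fin g ⊕ Fin g) ℚ)) hM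
  have e := mem_symplecticGroupOfForm_iff.1 hγ
  rw [typeFormOver, ← hMq, ← Matrix.transpose_map, ← Matrix.map_mul, ← Matrix.map_mul] at e
  rw [mem_symplecticLatticeGroup_iff]
  exact Matrix.map_injective (Int.castRingHom ℚ).injective_int e

/-- **The factorisation with an INTEGRAL symplectic left factor** — the head consumed by the B4 transport: for
`k₀ ∈ K_δ(1)` there are `M ∈ Sp_δ(ℤ)` (acting on `𝔥_g` by ★ `conjAct_map_intCast_jOfSiegel`: `M_ℚ · J(Z₀) = J(gDHom M • Z₀)`),
the (U3) data `(c, u, r)` and `k ∈ K_δ(N)` with `k₀ = M_𝔸 · r · k` and `ν(k₀) = u`.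
[cite: Milne2005ShimuraVarieties, §5 Lemma 5.13 p. 57 and Thm. 5.17 p. 59] [cite: Deligne1971TravauxShimura, Exemple 4.16 p. 150] -/
theorem exists_symplecticLatticeGroup_mul_principalRep_mul_level_of_mem_one (hδ : IsPolarizationType δ) (hg : 0 < g)
    {N : ℕ} (hN : N ≠ 0) (k₀ : gspFinAdelic δ) (hk₀ : k₀ ∈ principalLevelSubgroup δ 1) :
    ∃ (M : GL (Fin g ⊕ Fin g) ℤ) (hM : M ∈ symplecticLatticeGroup δ) (c : (ZMod N)ˣ) (u : finAdeleQˣ)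
      (r k : gspFinAdelic δ),
      (∀ v, Valued.v ((u : finAdeleQ) v) = 1) ∧
      (u : finAdeleQ) - ((c : ZMod N).val : ℕ) ∈ levelIdeal N ∧
      r ∈ principalLevelSubgroup δ 1 ∧
      IsMultiplier (typeFormOver δ finAdeleQ) (r : GL (Fin g ⊕ Fin g) finAdeleQ) u ∧
      ((r : GL (Fin g ⊕ Fin g) finAdeleQ) : Matrix (Fin g ⊕ Fin g) (Fin g ⊕ Fin g) finAdeleQ) =
        Matrix.fromBlocks 1 0 0 ((u : finAdeleQ) • (1 : Matrix (Fin g) (Fin g) finAdeleQ)) ∧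
      IsMultiplier (typeFormOver δ finAdeleQ) (k₀ : GL (Fin g ⊕ Fin g) finAdeleQ) u ∧
      k ∈ principalLevelSubgroup δ N ∧
      k₀ = gspRationalToFinAdelic δ ⟨Matrix.GeneralLinearGroup.map (Int.castRingHom ℚ) M,
              map_mem_gspRational_of_mem_symplecticLatticeGroup δ hM⟩ * r * k := by
  obtain ⟨γ, c, u, r, k, hγ, hγ1, hu, hc, hr, hru, hrmat, hν, hk, heq⟩ :=
    exists_rational_mul_principalRep_mul_level_of_mem_one δ hδ hg hN k₀ hk₀
  obtain ⟨M, hM, hMγ⟩ := exists_symplecticLatticeGroup_map_eq_of_mem_one δ γ hγ hγ1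
  have hγM : γ = ⟨Matrix.GeneralLinearGroup.map (Int.castRingHom ℚ) M,
      map_mem_gspRational_of_mem_symplecticLatticeGroup δ hM⟩ := Subtype.ext hMγ.symm
  exact ⟨M, hM, c, u, r, k, hu, hc, hr, hru, hrmat, hν, hk, hγM ▸ heq⟩

end Literature.AlgebraicGeometry.ModuliOfAbelianVarieties

end
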